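import Summits.BirchSwinnertonDyer.BirchSwinnertonDyer.Theorems.SignedLowerHalvesKobayashiMainConjectureSmallImageGaussInequality
import HarnessLib

/-!
# Route `SignedLowerHalves`, crux `KobayashiMainConjectureSmallImage` (item stmt-BirchSwinnertonDyer-19002):
# RATIONAL RIGIDITY off the anticyclotomic line — the two-variable Euler-system inclusion is needed only
# UP TO A NONZERO CONSTANT once `μ(G⁻) = 0` (cell `bsd-ssimc`, seat `bsd-line-slh-p3` gen 6, line `birth`/`acns`;
# THEOREMS ONLY, route-independent algebra over `𝒪_{ℂ_p}⟦T₂⟧⟦T₁⟧`; helper file `--supports` item 4)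

The acanchor/acns glue of routes `SignedBaseChange` / `SignedLowerHalves`
(`…Theorems.SignedBaseChangeK1Acanchor.le_span_of_anchor`, `map_le_span_of_anchor`) turns, PER FACTOR, the
INTEGRAL two-variable Euler-system inclusion (ES) `(G) ⊆ I·𝒪_{ℂ_p}⟦T₁,T₂⟧` (`I = ch(X_Gr₂)` principal), the
anticyclotomic anchor (ACdiv) `I|_{T₁=0} ⊆ (G⁻)` and (ACμ) `G⁻ ≠ 0` into the integral Eisenstein inclusion
`I·𝒪 ⊆ (G)` (rigidity: `G = c·h`, `c(0,·) = G(0,·)·m` ⇒ `h(0,·)·m = 1` ⇒ `h` a unit).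

THIS FILE proves the same conclusion from the RATIONAL Euler-system inclusion only —
`β · G ∈ I·𝒪` for SOME nonzero constant `β ∈ 𝒪_{ℂ_p}` (e.g. `β = p^a`, the shape every Euler-system
argument yields without the `τ`/big-image hypothesis, Rubin's Thm. 2.3.3) — provided ACμ is taken in the
form the compositions already have it, `μ(G⁻) = 0` (`HasUnitContent (minus G)`, Burungale–Castella–Skinner
2025 Prop. 4.2.2 BY NAME in every consumer): **`β·G = c·h`, `c₀ = G₀·m`, `G₀` of unit content ⇒ `I ⊆ (G)`**
(`le_span_of_anchor_rat`, `map_le_span_of_anchor_rat`, and the `p^a`-forms). NO algebraic `μ`, control or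
pseudo-nullity input is used (contrast line `ratlift` of crux stmt-BirchSwinnertonDyer-20728, which lifts
integrality through `μ(ch(X_ac)) = 0`).

Proof. Restricting to `T₁ = 0`: `β·G₀ = c₀h₀ = G₀ m h₀`, so `β = m·h₀` and `β = m(0)·α`, `α := h(0,0)`. The
point is the two-variable GAUSS INEQUALITY over the rank-one valuation ring `𝒪_{ℂ_p}` (companion file
`…SmallImageGaussInequality.lean`, `SmallImageGaussInequality.norm_coeff_mul_norm_coeff_le`): if every coefficient of `F·G` has norm `≤ b` then
`‖F_{kl}‖·‖G_{mn}‖ ≤ b` for all coefficients — proved WITHOUT a content function (suprema need not be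
attained over `𝒪_{ℂ_p}`): rescale both variables by `ϖ` with `ϖ^N = p` (`ℂ_p` is algebraically closed),
so that the weighted coefficient norms attain their maximum, divide by a maximal coefficient, and use that
`𝔽̄_p⟦T₂⟧⟦T₁⟧` (reduction modulo the maximal ideal) is a domain; then let `N → ∞`. Applied to
`c·h = β·G` it gives `‖c_{kl}‖·‖h_{ij}‖ ≤ ‖β‖`; applied on the line `T₁ = 0` to `G₀·m = c₀` it bounds
`‖m(0)‖` by the coefficients of `c₀`; together `‖h_{ij}‖ ≤ ‖α‖` for all `i, j`, i.e. `h = α·h'` with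
`h'(0,0) = 1` a unit, whence `c = (β/α)·G·h'⁻¹ ∈ (G)`.

HONEST SCOPE: pure commutative algebra; nothing about any curve is asserted; crux 4 OPEN; BSD is not proved
by any of this. Consumers: the companion `…SmallImageAcanchorGlueRat.lean` (T3 of line «acns» from the
RATIONAL T2), and — verbatim — the acanchor composition of `SignedBaseChange` with its ES stub
(crux 20728) weakened to line `ratlift`'s `stub_ratEulerSystemSS`.

References: [Rubin2000] Thm. 2.3.3 (the `p^t`-divisibility under `Hyp(K_∞, V)`);
[BourbakiAC5to7] VII §3 (Gauss's lemma / content over valuation rings — replaced here by the rescaling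
argument); [BurungaleCastellaSkinner2025] Prop. 4.2.2 (`μ(𝓛_p^Gr(f/K)⁻) = 0`); [BurungaleSkinnerTianWan2024]
Thm. 9.24 / §2.3 (the K1″ conclusion shape consuming the Eisenstein inclusion only).
-/

-- D-0017: single-problem summit, the namespace repeats the problem name by design.
set_option linter.dupNamespace false
set_option autoImplicit false

noncomputable section

open scoped Classical

namespace Summit.BirchSwinnertonDyer.BirchSwinnertonDyer.Theorems.SmallImageRationalRigidity

open PowerSeries Literature.NumberTheory.EllipticCurves Literature.NumberTheory.EllipticCurves.GreenbergVatsal2000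
  Literature.NumberTheory.EllipticCurves.UnrSeries₂
  Summit.BirchSwinnertonDyer.BirchSwinnertonDyer.Theorems.SmallImageGaussInequality

variable {p : ℕ} [Fact p.Prime]

/-! ## §1 Rational rigidity: `β·G ∈ (c)`, `c|_{T₁=0} ∈ (G⁻)`, `μ(G⁻) = 0` ⇒ `(c) ⊆ (G)` -/

/-- **Rational rigidity off the anticyclotomic line.** In `𝒪_{ℂ_p}⟦T₂⟧⟦T₁⟧` (outer variable `T₁`):
if `I` is principal, `β · G ∈ I` for a NONZERO CONSTANT `β ∈ 𝒪_{ℂ_p}` (the Euler-system inclusion up to a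
constant — e.g. `β = p^a`), the image of `I` under `T₁ ↦ 0` lies in `(G(0,·))` (the anticyclotomic anchor)
and `G(0,·)` has UNIT CONTENT (`μ(G⁻) = 0`), then `I ⊆ (G)` — the integral Eisenstein inclusion. With
`I = (c)`, `β G = c h`, `c₀ = G₀ m`: `β = m h₀`, `β = m(0)·h(0,0)`; the Gauss inequality (`SmallImageGaussInequality`) for `c·h = β·G`
and for `G₀·m = c₀` gives `‖h_{ij}‖ ≤ ‖h(0,0)‖` for all `i, j`, so `h = h(0,0)·h'` with `h'` a unit and
`c = (β/h(0,0))·G·h'⁻¹`. Supersedes the integral rigidity `…SignedBaseChangeK1Acanchor.le_span_of_anchor`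
(the case `β = 1`, where `G(0,·) ≠ 0` suffices). [folklore]
[cite: Rubin2000, Thm. 2.3.3 (the shape "char ∣ p^t · ind" of an Euler-system bound without the τ-hypothesis)] -/
theorem le_span_of_anchor_rat
    {I : Ideal (PowerSeries (PowerSeries (PadicComplexInt p)))} {G : PowerSeries (PowerSeries (PadicComplexInt p))}
    (hI : I.IsPrincipal) {β : PadicComplexInt p} (hβ : β ≠ 0) (hG : C (C β) * G ∈ I)
    (hanch : I.map (constantCoeff (R := PowerSeries (PadicComplexInt p))) ≤
      Ideal.span {constantCoeff (R := PowerSeries (PadicComplexInt p)) G})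
    (hμ : HasUnitContent (constantCoeff (R := PowerSeries (PadicComplexInt p)) G)) :
    I ≤ Ideal.span {G} := by
  obtain ⟨⟨c, hc⟩⟩ := hI
  have hc' : I = Ideal.span {c} := hc
  subst hc'
  -- `β G = c h` and `c₀ = G₀ m`
  obtain ⟨h, hh⟩ := Ideal.mem_span_singleton.mp hG
  have hc0mem : constantCoeff (R := PowerSeries (PadicComplexInt p)) c ∈
      Ideal.span {constantCoeff (R := PowerSeries (PadicComplexInt p)) G} :=
    hanch (Ideal.mem_map_of_mem _ (Ideal.mem_span_singleton_self c))
  obtain ⟨m, hm⟩ := Ideal.mem_span_singleton.mp hc0mem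
  set G₀ := constantCoeff (R := PowerSeries (PadicComplexInt p)) G with hG₀
  set c₀ := constantCoeff (R := PowerSeries (PadicComplexInt p)) c with hc₀
  set h₀ := constantCoeff (R := PowerSeries (PadicComplexInt p)) h with hh₀
  obtain ⟨n₀, hn₀⟩ := hμ
  have hG0 : G₀ ≠ 0 := by
    intro h0
    rw [h0, map_zero] at hn₀
    exact not_isUnit_zero hn₀
  -- on the line `T₁ = 0`: `β = m · h₀`, `β = m(0) · α`
  have e0 : C β * G₀ = c₀ * h₀ := by
    simpa using congr_arg (constantCoeff (R := PowerSeries (PadicComplexInt p))) hh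
  have e1 : C β = m * h₀ := by
    have h2 : G₀ * C β = G₀ * (m * h₀) := by rw [mul_comm, e0, hm]; ring
    exact mul_left_cancel₀ hG0 h2
  set α := constantCoeff (R := PadicComplexInt p) h₀ with hα'
  set m₀ := constantCoeff (R := PadicComplexInt p) m with hm₀'
  have e2 : β = m₀ * α := by
    simpa using congr_arg (constantCoeff (R := PadicComplexInt p)) e1
  have hα : α ≠ 0 := fun h0 ↦ hβ (by rw [e2, h0, mul_zero])
  have hm0 : m₀ ≠ 0 := fun h0 ↦ hβ (by rw [e2, h0, zero_mul])
  have e2n : ‖(β : ℂ_[p])‖ = ‖(m₀ : ℂ_[p])‖ * ‖(α : ℂ_[p])‖ := by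
    rw [e2]; push_cast; exact norm_mul _ _
  have hm0n : 0 < ‖(m₀ : ℂ_[p])‖ := norm_pos_of_ne_zero hm0
  -- every coefficient of `c · h = β · G` has norm `≤ ‖β‖`
  have hb1 : ∀ a b, ‖((coeff b (coeff a (c * h)) : PadicComplexInt p) : ℂ_[p])‖ ≤ ‖(β : ℂ_[p])‖ := by
    intro a b
    rw [← hh, coeff_coeff_C_C_mul]
    push_cast
    rw [norm_mul]
    exact mul_le_of_le_one_right (norm_nonneg _) (norm_coe_padicComplexInt_le_one _)
  -- KEY: `‖h_{ij}‖ ≤ ‖α‖` for all `i, j`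
  have key : ∀ i j, ‖((coeff j (coeff i h) : PadicComplexInt p) : ℂ_[p])‖ ≤ ‖(α : ℂ_[p])‖ := by
    intro i j
    refine le_of_not_gt fun hlt ↦ ?_
    have hhij : 0 < ‖((coeff j (coeff i h) : PadicComplexInt p) : ℂ_[p])‖ := (norm_nonneg _).trans_lt hlt
    -- Gauss on `c · h`: `‖c_{0,l'}‖ · ‖h_{ij}‖ ≤ ‖β‖`
    have G1 : ∀ l', ‖((coeff l' c₀ : PadicComplexInt p) : ℂ_[p])‖ *
        ‖((coeff j (coeff i h) : PadicComplexInt p) : ℂ_[p])‖ ≤ ‖(β : ℂ_[p])‖ := fun l' ↦ by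
      have h3 := norm_coeff_mul_norm_coeff_le c h hb1 0 l' i j
      rwa [coeff_zero_eq_constantCoeff_apply] at h3
    -- Gauss on `G₀ · m = c₀`: `‖m(0)‖ ≤ ‖β‖ / ‖h_{ij}‖`
    have hb2 : ∀ l', ‖((coeff l' (G₀ * m) : PadicComplexInt p) : ℂ_[p])‖ ≤
        ‖(β : ℂ_[p])‖ / ‖((coeff j (coeff i h) : PadicComplexInt p) : ℂ_[p])‖ := fun l' ↦ by
      rw [← hm]
      exact (le_div_iff₀ hhij).mpr (G1 l')
    have G2 := norm_coeff_mul_norm_coeff_le₁ G₀ m hb2 n₀ 0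
    rw [isUnit_padicComplexInt_iff.mp hn₀, one_mul, coeff_zero_eq_constantCoeff_apply] at G2
    have G3 : ‖(m₀ : ℂ_[p])‖ * ‖((coeff j (coeff i h) : PadicComplexInt p) : ℂ_[p])‖ ≤
        ‖(m₀ : ℂ_[p])‖ * ‖(α : ℂ_[p])‖ := by
      rw [← e2n]; exact (le_div_iff₀ hhij).mp G2
    have G4 : ‖(m₀ : ℂ_[p])‖ * ‖(α : ℂ_[p])‖ < ‖(m₀ : ℂ_[p])‖ *
        ‖((coeff j (coeff i h) : PadicComplexInt p) : ℂ_[p])‖ := mul_lt_mul_of_pos_left hlt hm0n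
    linarith
  -- so `h = α · h'` with `h'(0,0) = 1`
  have hdvd : ∀ i j, α ∣ coeff j (coeff i h) := fun i j ↦ padicComplexInt_dvd_of_norm_le (key i j)
  choose q hq using hdvd
  set h' : PowerSeries (PowerSeries (PadicComplexInt p)) := PowerSeries.mk fun i ↦ PowerSeries.mk fun j ↦ q i j
    with hh'def
  have hh' : h = C (C α) * h' := by
    refine PowerSeries.ext fun i ↦ PowerSeries.ext fun j ↦ ?_
    rw [coeff_coeff_C_C_mul, hh'def, coeff_mk, coeff_mk]
    exact hq i j
  have hq00 : q 0 0 = 1 := by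
    have e3 : α * q 0 0 = α * 1 := by
      rw [mul_one, ← hq 0 0, coeff_zero_eq_constantCoeff_apply, coeff_zero_eq_constantCoeff_apply]
    exact mul_left_cancel₀ hα e3
  have hunit' : IsUnit h' := by
    rw [PowerSeries.isUnit_iff_constantCoeff, PowerSeries.isUnit_iff_constantCoeff,
      ← coeff_zero_eq_constantCoeff_apply, ← coeff_zero_eq_constantCoeff_apply, hh'def, coeff_mk, coeff_mk,
      hq00]
    exact isUnit_one
  obtain ⟨u, hu⟩ := hunit'
  -- cancel `α`: `m(0) · G = c · h'`, so `c = m(0) · G · h'⁻¹ ∈ (G)`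
  have hCα : (C (C α) : PowerSeries (PowerSeries (PadicComplexInt p))) ≠ 0 := by
    intro h0
    apply hα
    have h4 := congr_arg (fun H ↦ coeff 0 (coeff 0 H)) h0
    simpa using h4
  have e4 : C (C α) * (C (C m₀) * G) = C (C α) * (c * h') := by
    calc C (C α) * (C (C m₀) * G) = C (C β) * G := by rw [e2, map_mul, map_mul]; ring
      _ = c * h := hh
      _ = C (C α) * (c * h') := by rw [hh']; ring
  have e5 := mul_left_cancel₀ hCα e4
  rw [← hu] at e5
  refine Ideal.span_singleton_le_span_singleton.mpr ⟨C (C m₀) * ↑u⁻¹, ?_⟩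
  calc c = c * ((u : PowerSeries (PowerSeries (PadicComplexInt p))) * ↑u⁻¹) := by rw [Units.mul_inv, mul_one]
    _ = (c * ↑u) * ↑u⁻¹ := by ring
    _ = C (C m₀) * G * ↑u⁻¹ := by rw [← e5]
    _ = G * (C (C m₀) * ↑u⁻¹) := by ring

/-! ## §2 In K1′/K1″'s receptacle: the extended characteristic ideal along a structure map `J` -/

/-- **Rational rigidity in the receptacle of K1′/K1″ (acanchor / acns glue).** For a principal ideal
`I ⊆ Λ_K = ℤ_p⟦T₂⟧⟦T₁⟧` and a structure map `J`: the RATIONAL Euler-system inclusion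
`β · G ∈ I·𝒪⟦T₁,T₂⟧` (`β ∈ 𝒪_{ℂ_p}` a nonzero constant), the anticyclotomic anchor
`(I·𝒪⟦T₁,T₂⟧)|_{T₁=0} ⊆ (G⁻)` and `μ(G⁻) = 0` (`HasUnitContent (minus G)`, the form in which BCS 2025 Prop.
4.2.2 is consumed) give the integral Eisenstein inclusion `I·𝒪⟦T₁,T₂⟧ ⊆ (G)`. The tree's
`…SignedBaseChangeK1Acanchor.map_le_span_of_anchor` is the case `β = 1`.
[cite: BurungaleCastellaSkinner2025, Prop. 4.2.2 (§4.2, p. 9 of arXiv:2405.00270v2) (the μ-input by name)]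
[cite: BurungaleSkinnerTianWan2024, Thm. 9.24 (the Eisenstein-direction conclusion shape of K1″)] -/
theorem map_le_span_of_anchor_rat {I : Ideal (IwasawaAlgebra₂ p)} (hI : I.IsPrincipal)
    (J : ℤ_[p] →+* PadicComplexInt p) {G : PowerSeries (PowerSeries (PadicComplexInt p))}
    {β : PadicComplexInt p} (hβ : β ≠ 0)
    (hES : C (C β) * G ∈ I.map (IwasawaAlgebra₂.toUnr₂ p J))
    (hμ : HasUnitContent (UnrSeries₂.minus G))
    (hanch : (I.map (IwasawaAlgebra₂.toUnr₂ p J)).map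
        (PowerSeries.constantCoeff (R := PowerSeries (PadicComplexInt p))) ≤
      Ideal.span {UnrSeries₂.minus G}) :
    I.map (IwasawaAlgebra₂.toUnr₂ p J) ≤ Ideal.span {G} := by
  have hP : (I.map (IwasawaAlgebra₂.toUnr₂ p J)).IsPrincipal := by
    obtain ⟨⟨c, hc⟩⟩ := hI
    have hc' : I = Ideal.span {c} := hc
    refine ⟨⟨IwasawaAlgebra₂.toUnr₂ p J c, ?_⟩⟩
    rw [hc', Ideal.map_span, Set.image_singleton]
  exact le_span_of_anchor_rat hP hβ hES hanch hμ

/-- `p ≠ 0` in `𝒪_{ℂ_p}`. [folklore] -/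
theorem natCast_p_ne_zero : (p : PadicComplexInt p) ≠ 0 := by
  intro h0
  have h1 := congr_arg (fun x : PadicComplexInt p ↦ (x : ℂ_[p])) h0
  push_cast at h1
  exact (Nat.cast_ne_zero.mpr (Fact.out : p.Prime).ne_zero) h1

/-- **The `p^a`-form** (the text of line `ratlift`'s `stub_ratEulerSystemSS` / line `acns`'s rational T2):
`(p^a · G) ⊆ I·𝒪⟦T₁,T₂⟧` for some `a`, the anchor and `μ(G⁻) = 0` give `I·𝒪⟦T₁,T₂⟧ ⊆ (G)`.
[cite: Rubin2000, Thm. 2.3.3 (divisibility up to p^t without the τ-hypothesis)]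
[cite: BurungaleCastellaSkinner2025, Prop. 4.2.2 (§4.2, p. 9 of arXiv:2405.00270v2)] -/
theorem map_le_span_of_anchor_natCast_pow {I : Ideal (IwasawaAlgebra₂ p)} (hI : I.IsPrincipal)
    (J : ℤ_[p] →+* PadicComplexInt p) {G : PowerSeries (PowerSeries (PadicComplexInt p))} (a : ℕ)
    (hES : Ideal.span {((p : ℕ) : PowerSeries (PowerSeries (PadicComplexInt p))) ^ a * G} ≤
      I.map (IwasawaAlgebra₂.toUnr₂ p J))
    (hμ : HasUnitContent (UnrSeries₂.minus G))
    (hanch : (I.map (IwasawaAlgebra₂.toUnr₂ p J)).map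
        (PowerSeries.constantCoeff (R := PowerSeries (PadicComplexInt p))) ≤
      Ideal.span {UnrSeries₂.minus G}) :
    I.map (IwasawaAlgebra₂.toUnr₂ p J) ≤ Ideal.span {G} := by
  have hβ : (p : PadicComplexInt p) ^ a ≠ 0 := pow_ne_zero _ natCast_p_ne_zero
  have hC : C (C ((p : PadicComplexInt p) ^ a)) * G =
      ((p : ℕ) : PowerSeries (PowerSeries (PadicComplexInt p))) ^ a * G := by
    rw [map_pow, map_pow, map_natCast, map_natCast]
  exact map_le_span_of_anchor_rat hI J hβ (hC ▸ hES (Ideal.mem_span_singleton_self _)) hμ hanch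

end Summit.BirchSwinnertonDyer.BirchSwinnertonDyer.Theorems.SmallImageRationalRigidity

end
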